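import Summits.HodgeConjecture.HodgeConjecture.Theses.CurveNetMordellWeil

/-!
# Route CurveNetMordellWeil — crux `VerticalSupportMiddle`, line tangential-carriers-period-syzygies:
the stub `stub_oddConiveauOne` (evidence for item stmt-HodgeConjecture-2782; helpers `--supports` it)

The line `tangential-carriers-period-syzygies` proves the crux `VerticalSupportMiddle` from three
stubs, the first of which is

  `OddConiveauOne := ∀ p ≥ 1, ∀ B smooth projective of dimension 2p + 1, every rational (p,p)-class
   c ∈ H²ᵖ(B(ℂ); ℂ) lies in N¹H²ᵖ = supportedClasses B (2p) 1`

("coniveau one below the middle on odd-dimensional varieties"). The crux as typed IMPLIES it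
(`verticalSupportMiddle_imp_coniveau_one_odd`, sibling file
`CurveNetMordellWeilVerticalSupportMiddleHardness`), so no line can avoid it; for `p ≥ 2` it is an
open statement of Hodge-conjecture strength (at `p = 2`: the Hodge conjecture for `(2,2)`-classes on
fivefolds read through Deligne's descent). This file records, machine-checked and with the stub
EXPANDED verbatim (Theorems files cannot import the Cruxes/Lines module), exactly where it sits:

* `oddConiveauOne_of_algebraic` — at a fixed `p ≥ 1` the stub follows from the codimension-`p`
  Hodge conjecture on smooth projective `(2p+1)`-folds alone: an algebraic class lies in
  `algebraicClasses B p = Nᵖ ⊆ N¹` (`supportedClasses_mono`);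
* `oddConiveauOne_of_hodgeConjecture` — hence the summit statement `HodgeConjecture` implies the
  stub outright (all `p ≥ 1`);
* `oddConiveauOne_one_of_lefschetzOneOne` — and its `p = 1` case follows from the route's own
  support item `LefschetzOneOne` (Lefschetz's theorem on `(1,1)`-classes, rational form:
  `algebraicClasses B 1 = supportedClasses B (2 * 1) 1` definitionally).

Nothing in the tree discharges the cases `p ≥ 2` (searched: `supportedClasses _ (2 * _) 1`,
`coniveau`, `ConiveauOne`, `generalizedHodge`, `GHC`; the only antecedents available are the open
`_root_.HodgeConjecture`, the open crux `Theses.HolomorphicDefect.HodgeClassesConiveauOne` of route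
HolomorphicDefect, and the abstract open `Motives.GeneralizedHodgeConjecture`). Inside the route's
deciding theorem `closes` (strong induction on the codimension) the stub at `p = q - 1` is the
induction hypothesis HC(q − 1); as a free-standing stub of item 2782 it stays open for `p ≥ 2`.
-/

noncomputable section

-- `Summit.HodgeConjecture.HodgeConjecture.Theorems` is the mandated namespace (single-problem summit:
-- Problem = Summit), which `linter.dupNamespace` flags on every declaration; the lakefile turns the
-- linter off tree-wide (weak option), restated here so stand-alone elaboration is warning-free too.
set_option linter.dupNamespace false

open Literature.AlgebraicGeometry.Motives Literature.AlgebraicGeometry.HodgeTheory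
open Summit.HodgeConjecture.HodgeConjecture.Theses.CurveNetMordellWeil (LefschetzOneOne)

namespace Summit.HodgeConjecture.HodgeConjecture.Theorems

/-- **Codimension-`p` Hodge conjecture on `(2p+1)`-folds ⟹ the stub at `p`.** If every rational
`(p,p)`-class on every smooth projective `B` of dimension `2p + 1` is algebraic
(`∈ algebraicClasses B p = Nᵖ H²ᵖ`), then for `p ≥ 1` it is supported in codimension `≥ 1`: the
coniveau filtration is decreasing, `Nᵖ ⊆ N¹` (`supportedClasses_mono`) — a cycle class dies off its
cycle. [cite: GrothendieckTopology1969, §1] [cite: Deligne2000, §2 Remark (vi)] -/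
theorem oddConiveauOne_of_algebraic {p : ℕ} (hp : 1 ≤ p)
    (h : ∀ ⦃B : SchemeOver ℂ⦄, IsSmoothProjective (2 * p + 1) B →
      ∀ c : complexBetti B (2 * p), IsRationalClass c → IsOfHodgeType (2 * p + 1) B (2 * p) p p c →
        c ∈ algebraicClasses B p)
    ⦃B : SchemeOver ℂ⦄ (hB : IsSmoothProjective (2 * p + 1) B) (c : complexBetti B (2 * p))
    (hc : IsRationalClass c) (hpp : IsOfHodgeType (2 * p + 1) B (2 * p) p p c) :
    c ∈ supportedClasses B (2 * p) 1 :=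
  supportedClasses_mono B (2 * p) hp (h hB c hc hpp)

/-- **The Hodge conjecture implies the stub `OddConiveauOne`** (expanded verbatim): for every
`p ≥ 1` and every smooth projective `B` of dimension `2p + 1`, a rational `(p,p)`-class is algebraic
by the cycle part of `HodgeConjectureFor (2p+1) B`, hence lies in `Nᵖ ⊆ N¹`
(`oddConiveauOne_of_algebraic`). So the stub is "HC-true"; for `p ≥ 2` no weaker antecedent is
available in the tree. [cite: Deligne2000, §1] [cite: GrothendieckTopology1969, §1] -/
theorem oddConiveauOne_of_hodgeConjecture : _root_.HodgeConjecture → ∀ ⦃p : ℕ⦄ ⦃B : SchemeOver ℂ⦄, 1 ≤ p → IsSmoothProjective (2 * p + 1) B → ∀ c : complexBetti B (2 * p), IsRationalClass c → IsOfHodgeType (2 * p + 1) B (2 * p) p p c → c ∈ supportedClasses B (2 * p) 1 :=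
  fun hHC p _ hp hB c hc hpp ↦
    oddConiveauOne_of_algebraic hp (fun _ hB' c' hc' hpp' ↦ (hHC hB').2 p c' hc' hpp') hB c hc hpp

/-- **The `p = 1` case of the stub from Lefschetz `(1,1)`** (the route's own support item
`LefschetzOneOne`, item stmt-HodgeConjecture-8544 = the Literature named fact
`lefschetzOneOne_rational` restated): on a smooth projective threefold `B` (dimension `2·1 + 1`) a
rational `(1,1)`-class lies in `algebraicClasses B 1`, which is `supportedClasses B (2 * 1) 1`
by definition (`algebraicClasses` is the `abbrev` `supportedClasses B (2 * p) p`).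
[cite: VoisinHodgeI2002, §11.3.3 Thm. 11.30] -/
theorem oddConiveauOne_one_of_lefschetzOneOne : LefschetzOneOne → ∀ ⦃B : SchemeOver ℂ⦄, IsSmoothProjective (2 * 1 + 1) B → ∀ c : complexBetti B (2 * 1), IsRationalClass c → IsOfHodgeType (2 * 1 + 1) B (2 * 1) 1 1 c → c ∈ supportedClasses B (2 * 1) 1 :=
  fun hL11 _ hB c hc hpp ↦ hL11 hB c hc hpp

end Summit.HodgeConjecture.HodgeConjecture.Theorems

end
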